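import Summits.BirchSwinnertonDyer.BirchSwinnertonDyer.Theorems.KolyvaginRoadThreePTDevissageCanonical
import Literature.NumberTheory.GaloisRepresentations.LocalGlobalCohomologyFiniteProofs
import HarnessLib

/-!
# Dévissage of Milne I Thm. 4.10(b) — the TRIVIAL PIECES: intertwining maps between trivial modules,
# triviality of the dual, and `Ш²(K, A) = 0` for a trivial module of prime order over `K ∋ μₚ`

Towards the instance of `middleExact_of_extension` for a 2-dimensional unipotent `𝔽ₚ`-module over a
number field containing `μₚ` (pieces `A`, `B` trivial of order `p`):

* `exists_intertwining_of_trivial` — any additive map between two modules with TRIVIAL Galois action is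
  an intertwining map;
* `tateDual_apply_eq_self_of_trivial` — if `Γ_K` acts trivially on `M` and on `μₙ`, it acts trivially
  on `M^D = Hom(M, μₙ)`;
* `sha_two_eq_zero_of_trivial_of_card_eq` — **`Ш²(K, A) = 0` for a trivial `Γ_K`-module `A` of prime
  order `p` when `K` contains a primitive `p`-th root of unity** (`A ≅ μₚ` as Galois modules by
  `addEquivOfPrimeCardEq`; then `sha_two_eq_zero_of_intertwining_mu`, i.e. Brauer–Hasse–Noether) — the
  obstruction group `hSha₁` of the dévissage for such a piece, and `hSha₃D` through
  `tateDual_apply_eq_self_of_trivial`.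

Theorems only; no case of BSD.  References: [MilneADT2006] I §0, Thm. 4.10; [CasselsFrohlichANT1967] VII §9.6.
-/

noncomputable section

open CategoryTheory Function NumberField IsDedekindDomain
open scoped NumberField ContRepresentation

universe u

set_option linter.dupNamespace false
set_option autoImplicit false

namespace Summit.BirchSwinnertonDyer.BirchSwinnertonDyer.Theorems.KolyvaginRoadThreePT

open Field
open Literature.NumberTheory.GaloisRepresentations Literature.NumberTheory.GaloisCohomology
open Literature.NumberTheory.GaloisRepresentations.DiscreteGaloisModule (mu MuCarrier TateDual tateDual)
open _root_.TopRep _root_.ContRepresentation _root_.ContinuousCohomology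

/-! ## §1. Intertwining maps between trivial modules; the dual of a trivial module -/

section Trivial

variable {K : Type u} [Field K]
variable {A B : Type u} [AddCommGroup A] [TopologicalSpace A] [DiscreteTopology A]
  [AddCommGroup B] [TopologicalSpace B] [DiscreteTopology B]

/-- **Any additive map between modules with trivial Galois action is intertwining.** [cite: MilneADT2006, Ch. I §0] -/
theorem exists_intertwining_of_trivial (ρA : DiscreteGaloisModule K A) (ρB : DiscreteGaloisModule K B)
    (hA : ∀ (σ : absoluteGaloisGroup K) (a : A), ρA σ a = a)
    (hB : ∀ (σ : absoluteGaloisGroup K) (b : B), ρB σ b = b) (e : A →+ B) :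
    ∃ φ : ρA.toContRepresentation →ⁱL ρB.toContRepresentation, ∀ a : A, φ a = e a := by
  refine ⟨{ toContinuousLinearMap := ⟨e.toIntLinearMap, continuous_of_discreteTopology⟩
            isIntertwining' := fun σ => ContinuousLinearMap.ext fun a => ?_ }, fun a => rfl⟩
  change e (ρA σ a) = ρB σ (e a)
  rw [hA, hB]

/-- **If `Γ_K` acts trivially on `M` and on `μₙ(K̄)`, it acts trivially on `M^D = Hom(M, μₙ)`.**
[cite: MilneADT2006, Ch. I §0 (M^D)] -/
theorem tateDual_apply_eq_self_of_trivial [Finite A] (n : ℕ) (ρA : DiscreteGaloisModule K A)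
    (hA : ∀ (σ : absoluteGaloisGroup K) (a : A), ρA σ a = a)
    (hμ : ∀ (σ : absoluteGaloisGroup K) (z : MuCarrier K n), mu K n σ z = z) :
    ∀ (σ : absoluteGaloisGroup K) (f : TateDual K A n), ρA.tateDual n σ f = f := by
  intro σ f
  refine DiscreteGaloisModule.TateDual.ext fun a => ?_
  rw [DiscreteGaloisModule.tateDual_apply_apply_apply, hA, hμ]

end Trivial

/-! ## §2. `Ш²(K, A) = 0` for a trivial module of prime order over `K ∋ μₚ` -/

section ShaTwoTrivial

variable {K : Type} [Field K] [NumberField K] {p : ℕ} [hp : Fact p.Prime]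
variable {A : Type} [AddCommGroup A] [TopologicalSpace A] [DiscreteTopology A]

/-- **`Ш²(K, A) = 0` for a `Γ_K`-module `A` of prime order `p` with TRIVIAL action, when `K` contains a
primitive `p`-th root of unity**: `A ≅ μₚ(K̄)` as Galois modules (both trivial, cyclic of order `p`), so
this is `Ш²(K, μₚ) = 0` (Brauer–Hasse–Noether + Hilbert 90) transported along the isomorphism
(`sha_two_eq_zero_of_intertwining_mu`).  The obstruction group `hSha₁` / `hSha₃D` of
`middleExact_of_extension` for the pieces of a unipotent `𝔽ₚ`-module over `K ∋ μₚ`.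
[cite: MilneADT2006, Ch. I, Thm. 4.10] [cite: CasselsFrohlichANT1967, Ch. VII §9.6] -/
theorem sha_two_eq_zero_of_trivial_of_card_eq {ζ : K} (hζ : IsPrimitiveRoot ζ p)
    (ρA : DiscreteGaloisModule K A) (hA : ∀ (σ : absoluteGaloisGroup K) (a : A), ρA σ a = a)
    (hcard : Nat.card A = p) (z : galoisCohomology ρA 2)
    (hz : ∀ v : Place K, galoisCohomology.localization ρA v 2 z = 0) : z = 0 := by
  haveI : NeZero p := ⟨hp.out.ne_zero⟩
  have hμ : ∀ (σ : absoluteGaloisGroup K) (w : MuCarrier K p), mu K p σ w = w :=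
    mu_apply_eq_self_of_isPrimitiveRoot K hζ
  have hcardμ : Nat.card (MuCarrier K p) = p :=
    HasEnoughRootsOfUnity.natCard_rootsOfUnity (AlgebraicClosure K) p
  let e : A ≃+ MuCarrier K p := addEquivOfPrimeCardEq hcard hcardμ
  obtain ⟨φ, hφ⟩ := exists_intertwining_of_trivial ρA (mu K p) hA hμ e.toAddMonoidHom
  obtain ⟨ψ, hψ⟩ := exists_intertwining_of_trivial (mu K p) ρA hμ hA e.symm.toAddMonoidHom
  refine sha_two_eq_zero_of_intertwining_mu ρA φ ψ (fun a => ?_) z hz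
  rw [hψ, hφ]
  exact e.symm_apply_apply a

/-- **`Ш²(K, A^D) = 0` for the dual of a trivial module of prime order over `K ∋ μₚ`** (`A^D` is again
trivial of order `p`: `tateDual_apply_eq_self_of_trivial` and `#Hom(A, μₚ) = #A`). The obstruction group
`hSha₃D` of `middleExact_of_extension` for a trivial top piece. [cite: MilneADT2006, Ch. I, Thm. 4.10] -/
theorem sha_two_tateDual_eq_zero_of_trivial_of_card_eq [Finite A] {ζ : K} (hζ : IsPrimitiveRoot ζ p)
    (ρA : DiscreteGaloisModule K A) (hA : ∀ (σ : absoluteGaloisGroup K) (a : A), ρA σ a = a)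
    (hpA : ∀ a : A, p • a = 0) (hcard : Nat.card A = p) (z : galoisCohomology (ρA.tateDual p) 2)
    (hz : ∀ v : Place K, galoisCohomology.localization (ρA.tateDual p) v 2 z = 0) : z = 0 := by
  haveI : NeZero p := ⟨hp.out.ne_zero⟩
  have hμ : ∀ (σ : absoluteGaloisGroup K) (w : MuCarrier K p), mu K p σ w = w :=
    mu_apply_eq_self_of_isPrimitiveRoot K hζ
  have hcardD : Nat.card (TateDual K A p) = p :=
    (HomCarrier.natCard_eq (muEquivZMod K p) hpA).trans hcard
  exact sha_two_eq_zero_of_trivial_of_card_eq hζ (ρA.tateDual p)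
    (tateDual_apply_eq_self_of_trivial p ρA hA hμ) hcardD z hz

end ShaTwoTrivial

end Summit.BirchSwinnertonDyer.BirchSwinnertonDyer.Theorems.KolyvaginRoadThreePT

end
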